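import Summits.CriticalPhenomena.CardyFormulaZ2.Theses.CardyWickAnisotropy

/-!
# Route CardyWickAnisotropy — the Vitali step (item `stmt-CriticalPhenomena-14546`)

`VitaliStep : DiscNormality → TaylorIdentification → RealAxisDictionary → AnisotropicBoxCardy`.

The complex-anisotropy crossing amplitudes `V n` are polynomials (entire functions). By
`DiscNormality` they are uniformly bounded on every closed disc `‖2p - 1‖ ≤ ρ`, `ρ < 1`; by
`TaylorIdentification` their jets at the self-dual point `p = 1/2` converge to the jets of a
function `G` holomorphic on the disc `D = ball (1/2) (1/2)`. Cauchy's inequalities turn the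
uniform bound into a geometric majorant of the Taylor coefficients, so dominated convergence
(Tannery) of the Taylor series gives `V n z → G z` for every `z ∈ D`. Evaluating at
`z = criticalWeight (α/2) ∈ (0, 1) ⊂ D` and using `RealAxisDictionary` (there `V n` is the real
crossing probability) and the value `G z = Π_h (cot (α/2))` gives `AnisotropicBoxCardy`.
-/

namespace Summit.CriticalPhenomena.CardyFormulaZ2.Theorems

open Filter Metric Complex Topology
open scoped Nat

/-- **Pointwise convergence on the disc from a uniform bound and convergence of the jets at the
centre.** If the `V n` are entire, uniformly bounded on each disc `‖2p - 1‖ ≤ ρ` (`ρ < 1`), and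
all their derivatives at `1/2` converge to those of a function `G` holomorphic on
`ball (1/2) (1/2)`, then `V n z → G z` for every `z` in that ball (Taylor expansion on the ball,
Cauchy's inequalities, dominated convergence of the series). -/
theorem tendsto_of_norm_le_of_tendsto_iteratedDeriv {V : ℕ → ℂ → ℂ} {G : ℂ → ℂ}
    (hV : ∀ n, Differentiable ℂ (V n))
    (hN : ∀ ρ : ℝ, ρ < 1 → ∃ C : ℝ, ∀ n : ℕ, ∀ p : ℂ, ‖2 * p - 1‖ ≤ ρ → ‖V n p‖ ≤ C)
    (hG : DifferentiableOn ℂ G (ball ((1 : ℂ) / 2) (1 / 2)))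
    (hT : ∀ k : ℕ, Tendsto (fun n : ℕ ↦ iteratedDeriv k (V n) ((1 : ℂ) / 2)) atTop
      (𝓝 (iteratedDeriv k G ((1 : ℂ) / 2))))
    {z : ℂ} (hz : z ∈ ball ((1 : ℂ) / 2) (1 / 2)) :
    Tendsto (fun n ↦ V n z) atTop (𝓝 (G z)) := by
  set c : ℂ := (1 : ℂ) / 2 with hc
  have hz' : ‖z - c‖ < 1 / 2 := by rwa [mem_ball_iff_norm] at hz
  obtain ⟨R, hzR, hR⟩ := exists_between hz'
  have hR0 : 0 < R := lt_of_le_of_lt (norm_nonneg _) hzR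
  obtain ⟨C, hC⟩ := hN (2 * R) (by linarith)
  -- Cauchy's inequalities on the circle of radius `R` about `c`
  have hcauchy : ∀ n k, ‖iteratedDeriv k (V n) c‖ ≤ k ! * C / R ^ k := by
    intro n k
    refine Complex.norm_iteratedDeriv_le_of_forall_mem_sphere_norm_le k hR0
      (hV n).diffContOnCl fun p hp ↦ hC n p (le_of_eq ?_)
    rw [mem_sphere_iff_norm] at hp
    have h2 : 2 * p - 1 = 2 * (p - c) := by rw [hc]; ring
    rw [h2, norm_mul, hp]
    simp
  -- Taylor expansions on the ball
  have hVsum : ∀ n, ∑' k, (k ! : ℂ)⁻¹ • (z - c) ^ k • iteratedDeriv k (V n) c = V n z :=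
    fun n ↦ Complex.taylorSeries_eq_on_ball (hV n).differentiableOn hz
  have hGsum : ∑' k, (k ! : ℂ)⁻¹ • (z - c) ^ k • iteratedDeriv k G c = G z :=
    Complex.taylorSeries_eq_on_ball hG hz
  -- dominated convergence of the series
  have key : Tendsto (fun n ↦ ∑' k, (k ! : ℂ)⁻¹ • (z - c) ^ k • iteratedDeriv k (V n) c) atTop
      (𝓝 (∑' k, (k ! : ℂ)⁻¹ • (z - c) ^ k • iteratedDeriv k G c)) := by
    refine tendsto_tsum_of_dominated_convergence (bound := fun k ↦ C * (‖z - c‖ / R) ^ k)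
      ?_ ?_ ?_
    · exact (summable_geometric_of_lt_one (by positivity) ((div_lt_one hR0).2 hzR)).mul_left C
    · intro k
      exact ((hT k).const_smul _).const_smul _
    · refine Eventually.of_forall fun n k ↦ ?_
      have hk : (k ! : ℝ) ≠ 0 := by positivity
      rw [norm_smul, norm_smul, norm_inv, norm_pow, Complex.norm_natCast]
      calc (k ! : ℝ)⁻¹ * (‖z - c‖ ^ k * ‖iteratedDeriv k (V n) c‖)
          ≤ (k ! : ℝ)⁻¹ * (‖z - c‖ ^ k * (k ! * C / R ^ k)) := by gcongr; exact hcauchy n k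
        _ = C * (‖z - c‖ / R) ^ k := by rw [div_pow]; field_simp
  rw [← hGsum]
  exact key.congr fun n ↦ hVsum n

/-- Real-valued form of `tendsto_of_norm_le_of_tendsto_iteratedDeriv`: if moreover `V n z` is the
real number `x n` and `G z` is the real number `L`, then `x n → L`. -/
theorem tendsto_real_of_norm_le_of_tendsto_iteratedDeriv {V : ℕ → ℂ → ℂ} {G : ℂ → ℂ}
    {x : ℕ → ℝ} {L : ℝ} {z : ℂ}
    (hV : ∀ n, Differentiable ℂ (V n))
    (hN : ∀ ρ : ℝ, ρ < 1 → ∃ C : ℝ, ∀ n : ℕ, ∀ p : ℂ, ‖2 * p - 1‖ ≤ ρ → ‖V n p‖ ≤ C)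
    (hG : DifferentiableOn ℂ G (ball ((1 : ℂ) / 2) (1 / 2)))
    (hT : ∀ k : ℕ, Tendsto (fun n : ℕ ↦ iteratedDeriv k (V n) ((1 : ℂ) / 2)) atTop
      (𝓝 (iteratedDeriv k G ((1 : ℂ) / 2))))
    (hz : z ∈ ball ((1 : ℂ) / 2) (1 / 2))
    (hx : ∀ n, V n z = ((x n : ℝ) : ℂ)) (hL : G z = ((L : ℝ) : ℂ)) :
    Tendsto x atTop (𝓝 L) := by
  have h := tendsto_of_norm_le_of_tendsto_iteratedDeriv hV hN hG hT hz
  rw [hL] at h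
  have h2 : Tendsto (fun n ↦ ((x n : ℝ) : ℂ)) atTop (𝓝 ((L : ℝ) : ℂ)) := h.congr hx
  have h3 := (Complex.continuous_re.tendsto _).comp h2
  simpa [Function.comp_def] using h3

/-- The canonical critical weight `criticalWeight (α/2)`, `α ∈ (0, π)`, cast to `ℂ`, lies in the
disc `ball (1/2) (1/2)`: both sines in its definition are positive, so it lies in `(0, 1)`. -/
theorem criticalWeight_half_mem_ball {α : ℝ} (hα : α ∈ Set.Ioo (0 : ℝ) Real.pi) :
    ((Literature.Probability.LatticeModels.criticalWeight (α / 2) : ℝ) : ℂ) ∈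
      ball ((1 : ℂ) / 2) (1 / 2) := by
  obtain ⟨h0, hπ⟩ := hα
  have ha : 0 < Real.sin (2 * (α / 2) / 3) :=
    Real.sin_pos_of_pos_of_lt_pi (by linarith) (by linarith [Real.pi_pos])
  have hb : 0 < Real.sin ((Real.pi - 2 * (α / 2)) / 3) :=
    Real.sin_pos_of_pos_of_lt_pi (by linarith) (by linarith [Real.pi_pos])
  set w := Literature.Probability.LatticeModels.criticalWeight (α / 2) with hw
  have hw0 : 0 < w := div_pos ha (add_pos ha hb)
  have hw1 : w < 1 := (div_lt_one (add_pos ha hb)).2 (by linarith)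
  have hsub : (w : ℂ) - (1 : ℂ) / 2 = ((w - 1 / 2 : ℝ) : ℂ) := by push_cast; ring
  rw [mem_ball_iff_norm, hsub, Complex.norm_real, Real.norm_eq_abs, abs_lt]
  constructor <;> linarith

/-- **Item `stmt-CriticalPhenomena-14546` (support VitaliStep of route CardyWickAnisotropy).**
`DiscNormality → TaylorIdentification → RealAxisDictionary → AnisotropicBoxCardy`: the uniform
bound on compact sub-discs of `D` and the convergence of the jets at the self-dual square give
`V n → G` pointwise on `D` (Taylor series + Cauchy inequalities + dominated convergence); at
`p = criticalWeight (α/2) ∈ (0,1) ⊂ D` the dictionary identifies `V n p` with the crossing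
probability and `G p` with `Π_h (cot (α/2))`. -/
theorem vitaliStep_proof :
    Summit.CriticalPhenomena.CardyFormulaZ2.Theses.CardyWickAnisotropy.VitaliStep := by
  dsimp only [Summit.CriticalPhenomena.CardyFormulaZ2.Theses.CardyWickAnisotropy.VitaliStep,
    Summit.CriticalPhenomena.CardyFormulaZ2.Theses.CardyWickAnisotropy.DiscNormality,
    Summit.CriticalPhenomena.CardyFormulaZ2.Theses.CardyWickAnisotropy.TaylorIdentification,
    Summit.CriticalPhenomena.CardyFormulaZ2.Theses.CardyWickAnisotropy.RealAxisDictionary,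
    Summit.CriticalPhenomena.CardyFormulaZ2.Theses.CardyWickAnisotropy.AnisotropicBoxCardy]
  intro hN hT hU α hα
  obtain ⟨G, hG, hGval, hjet⟩ := hT
  refine tendsto_real_of_norm_le_of_tendsto_iteratedDeriv ?_ hN hG hjet
    (criticalWeight_half_mem_ball hα) (hU α hα) (hGval α hα)
  -- each `V n` is a polynomial in `p`, hence entire
  intro n
  refine Differentiable.fun_sum fun ω _ ↦ ?_
  by_cases hω : ((ω : Set (Sym2 (Literature.Probability.LatticeModels.Site 2))) ∈
      Literature.Probability.Percolation.lrCrossing (n + 1) n)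
  · simp only [hω, ↓reduceIte]
    refine Differentiable.fun_finsetProd fun e _ ↦ ?_
    by_cases he : e ∈ ω <;>
      by_cases hh : (∃ x y : Literature.Probability.LatticeModels.Site 2, e = s(x, y) ∧ x 1 = y 1) <;>
      simp only [he, hh, ↓reduceIte] <;> fun_prop
  · simp only [hω, ↓reduceIte]
    exact differentiable_const 0

end Summit.CriticalPhenomena.CardyFormulaZ2.Theorems
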